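/-
VALUE = THEOREM, NOT summit progress (cell b2b-lgcu-borel, gen 22); crux 14079 untouched.
-/
import Mathlib
import Summits.MatrixMultiplication.MatrixMultiplication.Theorems.SubgroupIdentityDesigns.Negative.CuspidalObstruction
import Summits.MatrixMultiplication.MatrixMultiplication.Theorems.SubgroupIdentityDesigns.Negative.SummandTransport

/-!
# The cuspidal obstruction: placements in `GL₂(𝔽_p)` and in every `GL_m(𝔽_p)`, `m ≥ 2`

VALUE = THEOREM (every odd `p`, every `m ≥ 2`, every `ε`), NOT summit progress; the crux item
stmt-MatrixMultiplication-14079 is untouched and remains open.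

`CuspidalObstruction.no_design_of_cover`: if every `s ∈ SL₂(𝔽_p) ∖ 1` (`p` odd) is a triple
product `a b c` with `a ∈ H₁, b ∈ H₂, c ∈ H₃ ≤ GL₂(𝔽_p)`, then `(H₁, H₂, H₃)` carries no
level-one identity design — the cusp form `μ = [tr = t₀] - [tr = 2] + p·[s = 1]` (`t₀` an elliptic
trace) kills the level-one space but not the design's test function.  This file supplies the
elliptic trace (`exists_elliptic`: if every `t² - 4` were a square, induction would make every
`-4n` one, contradicting `FiniteField.exists_nonsquare`) and the PLACEMENTS:

* `no_design_mem₁/₂/₃` — no member of a triple with a level-one identity design in `GL₂(𝔽_p)`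
  contains `SL₂(𝔽_p)`;
* `no_design_split` — the split `U⁻ ≤ H₁`, `N(T) ≤ H₂` (diagonal torus of `SL₂` and its Weyl
  coset `[[0, -α], [α⁻¹, 0]]`), `U ≤ H₃` is impossible, by the factorisation
  `SL₂ = U⁻ T U ∪ T w U` (`cover_split`: `s = u⁻_{c/a} · diag(a, a⁻¹) · u_{b/a}` if `s₀₀ = a ≠ 0`,
  `s = [[0, -α], [α⁻¹, 0]] · u_{α d}` with `α = -s₀₁` if `s₀₀ = 0`).  Unlike the Bruhat-type splits
  (`B ∋ -1` in one member and `w`, `w² = -1`, in another, which violate the TPP trivially), this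
  configuration is TPP-compatible: `(U⁻, N(T), U)` is itself a subgroup-TPP triple
  (`U⁻U ∩ N(T) = 1`);
* `no_design_of_blockCover`, `no_design_mem₁/₂/₃_all`, `no_design_split_all` — the same in
  `GL_m(𝔽_p)` for the block `SL₂(𝔽_p) ⊕ 1_{m-2}` on ANY two coordinates
  (`e : Fin 2 ⊕ Fin l ≃ Fin m`), through `SummandTransport.design_comap`: a design in `GL_m`
  restricts to one for the pulled-back triple in `GL₂`, whose product set still covers `SL₂ ∖ 1`.

For `m ≥ 3` none of the earlier criteria reaches these configurations when `p ≥ 5`: the block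
`SL₂(𝔽_p) ⊕ 1` is perfect (no admissibility / determinant / split-functional certificate), has
order divisible by `p` (no fixer certificate), contains no full translation group `T(ℓ)` and no
root chain, and no volume law is available in `GL_m`, `m ≥ 3`.  No TPP and no budget hypothesis
is used, so the exclusions hold for every `ε`.

DATA (`(m,p) = (3,5)`, exact, code/g22/order120_check.py of the cell): the generation-21 GAP scan counted 79
non-carrier classes of order `≤ 122` in `GL₃(𝔽₅)` but printed only the 76 of order `≤ 100` (13 minimal);
the three unprinted ones are the order-`120` classes `SL₂(𝔽₅) ⊕ 1` (minimal; excluded for all odd `p` by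
this file), the sign-twisted `SO₃(𝔽₅) ≅ S₅` (minimal; its missing representation is cuspidal too — no
theorem here yet) and `Ω₃(𝔽₅) × ⟨-1⟩` (not minimal); `SO₃(𝔽₅) ≅ PGL₂(𝔽₅)` itself is a carrier.

HONEST SCOPE.  Configuration exclusions; no `(p,m,ε)` cell is emptied.
-/

set_option linter.dupNamespace false

noncomputable section

open scoped BigOperators Classical Matrix

namespace Summit.MatrixMultiplication.MatrixMultiplication.Theorems.SubgroupIdentityDesigns.Negative
namespace CuspidalObstruction

open Summit.MatrixMultiplication.MatrixMultiplication.Theorems.LieRankDesigns.Negative (GLm Mat)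
open SummandTransport (emb design_comap)

variable {p : ℕ} [hp : Fact p.Prime]

/-! ## Elliptic traces exist -/

/-- **An elliptic trace exists for odd `p`.**  If every `t² - 4` were a square, then by induction
every `-4n` would be one, i.e. every element of `𝔽_p` (`4` is a unit), contradicting
`FiniteField.exists_nonsquare`. -/
theorem exists_elliptic (hp2 : p ≠ 2) : ∃ t₀ : ZMod p, ¬ IsSquare (t₀ ^ 2 - 4) := by
  by_contra hall
  simp only [not_exists, not_not] at hall
  have h4 : (4 : ZMod p) ≠ 0 := by
    intro h
    have h' : ((4 : ℕ) : ZMod p) = 0 := by exact_mod_cast h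
    rw [ZMod.natCast_eq_zero_iff] at h'
    have h2 : p ∣ 2 := hp.out.dvd_of_dvd_pow (n := 2) (by simpa using h')
    exact hp2 ((Nat.prime_dvd_prime_iff_eq hp.out Nat.prime_two).mp h2)
  have hind : ∀ n : ℕ, IsSquare (-4 * (n : ZMod p)) := by
    intro n
    induction n with
    | zero => exact ⟨0, by simp⟩
    | succ n ih =>
      obtain ⟨r, hr⟩ := ih
      have h := hall r
      have e : r ^ 2 - 4 = -4 * ((n + 1 : ℕ) : ZMod p) := by
        rw [sq, ← hr]; push_cast; ring
      rwa [e] at h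
  have hsq : ∀ a : ZMod p, IsSquare a := by
    intro a
    have e : -4 * ((((-4 : ZMod p)⁻¹ * a).val : ℕ) : ZMod p) = a := by
      rw [ZMod.natCast_zmod_val, ← mul_assoc, mul_inv_cancel₀ (neg_ne_zero.mpr h4), one_mul]
    rw [← e]
    exact hind _
  have hchar : ringChar (ZMod p) ≠ 2 := by rw [ZMod.ringChar_zmod_n]; exact hp2
  obtain ⟨a, ha⟩ := FiniteField.exists_nonsquare hchar
  exact ha (hsq a)

/-! ## The pieces `U⁻`, `T`, `T w` of `SL₂(𝔽_p)` and the factorisation -/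

/-- The lower root element `u⁻_x = [[1, 0], [x, 1]]`. -/
def lx (x : ZMod p) : SL2 p := ⟨!![(1 : ZMod p), 0; x, 1], by rw [Matrix.det_fin_two_of]; ring⟩

/-- The torus element `diag(α, α⁻¹)`. -/
def tdiag (α : (ZMod p)ˣ) : SL2 p :=
  ⟨!![(α : ZMod p), 0; 0, (α : ZMod p)⁻¹], by
    rw [Matrix.det_fin_two_of, mul_inv_cancel₀ α.ne_zero]; ring⟩

/-- The Weyl-coset element `diag(α, α⁻¹) w = [[0, -α], [α⁻¹, 0]]` of `N(T) ∖ T`. -/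
def tw (α : (ZMod p)ˣ) : SL2 p :=
  ⟨!![(0 : ZMod p), -(α : ZMod p); (α : ZMod p)⁻¹, 0], by
    rw [Matrix.det_fin_two_of, neg_mul, mul_inv_cancel₀ α.ne_zero]; ring⟩

/-- Underlying matrix of `u⁻_x`. -/
theorem coe_lx (x : ZMod p) : ((lx x : SL2 p) : Mat p 2) = !![(1 : ZMod p), 0; x, 1] := rfl

/-- Underlying matrix of `diag(α, α⁻¹)`. -/
theorem coe_tdiag (α : (ZMod p)ˣ) :
    ((tdiag α : SL2 p) : Mat p 2) = !![(α : ZMod p), 0; 0, (α : ZMod p)⁻¹] := rfl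

/-- Underlying matrix of `[[0, -α], [α⁻¹, 0]]`. -/
theorem coe_tw (α : (ZMod p)ˣ) :
    ((tw α : SL2 p) : Mat p 2) = !![(0 : ZMod p), -(α : ZMod p); (α : ZMod p)⁻¹, 0] := rfl

/-- Entries of `u⁻_x · diag(α, α⁻¹) · u_y`. -/
theorem coe_lx_tdiag_ux (x y : ZMod p) (α : (ZMod p)ˣ) :
    ((lx x * tdiag α * ux y : SL2 p) : Mat p 2) =
      !![(α : ZMod p), (α : ZMod p) * y;
         x * (α : ZMod p), x * (α : ZMod p) * y + (α : ZMod p)⁻¹] := by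
  rw [Matrix.SpecialLinearGroup.coe_mul, Matrix.SpecialLinearGroup.coe_mul, coe_lx, coe_tdiag,
    coe_ux, Matrix.mul_fin_two, Matrix.mul_fin_two]
  simp only [one_mul, zero_mul, mul_one, mul_zero, add_zero, zero_add]

/-- Entries of `[[0, -α], [α⁻¹, 0]] · u_y`. -/
theorem coe_tw_ux (y : ZMod p) (α : (ZMod p)ˣ) :
    ((tw α * ux y : SL2 p) : Mat p 2) =
      !![(0 : ZMod p), -(α : ZMod p); (α : ZMod p)⁻¹, (α : ZMod p)⁻¹ * y] := by
  rw [Matrix.SpecialLinearGroup.coe_mul, coe_tw, coe_ux, Matrix.mul_fin_two]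
  simp only [zero_mul, mul_one, mul_zero, add_zero, zero_add]

/-- **`SL₂ = U⁻ T U ∪ T w U`**: every `s ∈ SL₂(𝔽_p)` is `u⁻_x · diag(α, α⁻¹) · u_y` (when
`s₀₀ ≠ 0`) or `[[0, -α], [α⁻¹, 0]] · u_y` (when `s₀₀ = 0`). -/
theorem cover_split (s : SL2 p) : ∃ (x y : ZMod p) (α : (ZMod p)ˣ),
    s = lx x * tdiag α * ux y ∨ s = tw α * ux y := by
  have hdet : (s : Mat p 2) 0 0 * (s : Mat p 2) 1 1 - (s : Mat p 2) 0 1 * (s : Mat p 2) 1 0 = 1 := by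
    have h := s.2
    rw [Matrix.det_fin_two] at h
    exact h
  by_cases h0 : (s : Mat p 2) 0 0 = 0
  · -- `s = [[0, b], [c, d]]` with `-b c = 1`
    have hbc : -(s : Mat p 2) 0 1 * (s : Mat p 2) 1 0 = 1 := by
      rw [h0, zero_mul, zero_sub] at hdet; rw [neg_mul]; exact hdet
    have hb : -(s : Mat p 2) 0 1 ≠ 0 := fun h => by rw [h, zero_mul] at hbc; exact zero_ne_one hbc
    refine ⟨0, -(s : Mat p 2) 0 1 * (s : Mat p 2) 1 1, Units.mk0 _ hb, Or.inr ?_⟩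
    apply Matrix.SpecialLinearGroup.ext
    intro i j
    rw [coe_tw_ux]
    fin_cases i <;> fin_cases j
    · exact h0
    · show (s : Mat p 2) 0 1 = -(-(s : Mat p 2) 0 1)
      rw [neg_neg]
    · show (s : Mat p 2) 1 0 = (-(s : Mat p 2) 0 1)⁻¹
      exact (inv_eq_of_mul_eq_one_right hbc).symm
    · show (s : Mat p 2) 1 1 = (-(s : Mat p 2) 0 1)⁻¹ * (-(s : Mat p 2) 0 1 * (s : Mat p 2) 1 1)
      rw [inv_eq_of_mul_eq_one_right hbc, ← mul_assoc, mul_comm ((s : Mat p 2) 1 0), hbc, one_mul]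
  · -- `s₀₀ = a ≠ 0`
    refine ⟨(s : Mat p 2) 1 0 * ((s : Mat p 2) 0 0)⁻¹, (s : Mat p 2) 0 1 * ((s : Mat p 2) 0 0)⁻¹,
      Units.mk0 _ h0, Or.inl ?_⟩
    apply Matrix.SpecialLinearGroup.ext
    intro i j
    rw [coe_lx_tdiag_ux]
    fin_cases i <;> fin_cases j
    · rfl
    · show (s : Mat p 2) 0 1 = (s : Mat p 2) 0 0 * ((s : Mat p 2) 0 1 * ((s : Mat p 2) 0 0)⁻¹)
      rw [← mul_assoc, mul_comm ((s : Mat p 2) 0 0) ((s : Mat p 2) 0 1), mul_inv_cancel_right₀ h0]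
    · show (s : Mat p 2) 1 0 = (s : Mat p 2) 1 0 * ((s : Mat p 2) 0 0)⁻¹ * (s : Mat p 2) 0 0
      rw [inv_mul_cancel_right₀ h0]
    · show (s : Mat p 2) 1 1 = (s : Mat p 2) 1 0 * ((s : Mat p 2) 0 0)⁻¹ * (s : Mat p 2) 0 0 *
          ((s : Mat p 2) 0 1 * ((s : Mat p 2) 0 0)⁻¹) + ((s : Mat p 2) 0 0)⁻¹
      rw [inv_mul_cancel_right₀ h0]
      apply mul_left_cancel₀ h0
      rw [mul_add, mul_inv_cancel₀ h0]
      linear_combination hdet - ((s : Mat p 2) 0 1 * (s : Mat p 2) 1 0) *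
        (mul_inv_cancel₀ h0 : (s : Mat p 2) 0 0 * ((s : Mat p 2) 0 0)⁻¹ = 1)

section GL2

variable {H₁ H₂ H₃ : Subgroup (GLm p 2)}

/-- **No member contains `SL₂(𝔽_p)`** (`p` odd): member `1`. -/
theorem no_design_mem₁ (hp2 : p ≠ 2) (hSL : ∀ s : SL2 p, Matrix.SpecialLinearGroup.toGL s ∈ H₁) :
    ¬ ∃ c : Mat p 2 → ℂ, (∀ M, 1 < M.rank → c M = 0) ∧
      (∑ M, c M * ZMod.stdAddChar (Matrix.trace (M * ((1 : GLm p 2) : Mat p 2)))) = 1 ∧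
      ∀ a ∈ H₁, ∀ b ∈ H₂, ∀ g ∈ H₃, a * b * g ≠ 1 →
        (∑ M, c M * ZMod.stdAddChar (Matrix.trace (M * ((a * b * g : GLm p 2) : Mat p 2)))) = 0 := by
  obtain ⟨t₀, ht₀⟩ := exists_elliptic hp2
  exact no_design_of_cover ht₀ fun s _ =>
    ⟨_, hSL s, 1, H₂.one_mem, 1, H₃.one_mem, by rw [mul_one, mul_one]⟩

/-- **No member contains `SL₂(𝔽_p)`** (`p` odd): member `2`. -/
theorem no_design_mem₂ (hp2 : p ≠ 2) (hSL : ∀ s : SL2 p, Matrix.SpecialLinearGroup.toGL s ∈ H₂) :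
    ¬ ∃ c : Mat p 2 → ℂ, (∀ M, 1 < M.rank → c M = 0) ∧
      (∑ M, c M * ZMod.stdAddChar (Matrix.trace (M * ((1 : GLm p 2) : Mat p 2)))) = 1 ∧
      ∀ a ∈ H₁, ∀ b ∈ H₂, ∀ g ∈ H₃, a * b * g ≠ 1 →
        (∑ M, c M * ZMod.stdAddChar (Matrix.trace (M * ((a * b * g : GLm p 2) : Mat p 2)))) = 0 := by
  obtain ⟨t₀, ht₀⟩ := exists_elliptic hp2
  exact no_design_of_cover ht₀ fun s _ =>
    ⟨1, H₁.one_mem, _, hSL s, 1, H₃.one_mem, by rw [one_mul, mul_one]⟩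

/-- **No member contains `SL₂(𝔽_p)`** (`p` odd): member `3`. -/
theorem no_design_mem₃ (hp2 : p ≠ 2) (hSL : ∀ s : SL2 p, Matrix.SpecialLinearGroup.toGL s ∈ H₃) :
    ¬ ∃ c : Mat p 2 → ℂ, (∀ M, 1 < M.rank → c M = 0) ∧
      (∑ M, c M * ZMod.stdAddChar (Matrix.trace (M * ((1 : GLm p 2) : Mat p 2)))) = 1 ∧
      ∀ a ∈ H₁, ∀ b ∈ H₂, ∀ g ∈ H₃, a * b * g ≠ 1 →
        (∑ M, c M * ZMod.stdAddChar (Matrix.trace (M * ((a * b * g : GLm p 2) : Mat p 2)))) = 0 := by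
  obtain ⟨t₀, ht₀⟩ := exists_elliptic hp2
  exact no_design_of_cover ht₀ fun s _ =>
    ⟨1, H₁.one_mem, 1, H₂.one_mem, _, hSL s, by rw [one_mul, one_mul]⟩

/-- **THE TPP-COMPATIBLE SPLIT IS IMPOSSIBLE** (`p` odd): `U⁻ ≤ H₁`, `N(T) ≤ H₂`, `U ≤ H₃`
(it suffices that the members contain the listed elements). -/
theorem no_design_split (hp2 : p ≠ 2)
    (h₁ : ∀ x : ZMod p, Matrix.SpecialLinearGroup.toGL (lx x) ∈ H₁)
    (h₂ : ∀ α : (ZMod p)ˣ, Matrix.SpecialLinearGroup.toGL (tdiag α) ∈ H₂)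
    (h₂' : ∀ α : (ZMod p)ˣ, Matrix.SpecialLinearGroup.toGL (tw α) ∈ H₂)
    (h₃ : ∀ y : ZMod p, Matrix.SpecialLinearGroup.toGL (ux y) ∈ H₃) :
    ¬ ∃ c : Mat p 2 → ℂ, (∀ M, 1 < M.rank → c M = 0) ∧
      (∑ M, c M * ZMod.stdAddChar (Matrix.trace (M * ((1 : GLm p 2) : Mat p 2)))) = 1 ∧
      ∀ a ∈ H₁, ∀ b ∈ H₂, ∀ g ∈ H₃, a * b * g ≠ 1 →
        (∑ M, c M * ZMod.stdAddChar (Matrix.trace (M * ((a * b * g : GLm p 2) : Mat p 2)))) = 0 := by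
  obtain ⟨t₀, ht₀⟩ := exists_elliptic hp2
  refine no_design_of_cover ht₀ fun s _ => ?_
  obtain ⟨x, y, α, h | h⟩ := cover_split s
  · exact ⟨_, h₁ x, _, h₂ α, _, h₃ y, by rw [h, map_mul, map_mul]⟩
  · exact ⟨1, H₁.one_mem, _, h₂' α, _, h₃ y, by rw [h, map_mul, one_mul]⟩

end GL2

/-! ## Every dimension `m ≥ 2`: the block `SL₂(𝔽_p) ⊕ 1` -/

section GLm

variable {l m : ℕ} (e : Fin 2 ⊕ Fin l ≃ Fin m) {H₁ H₂ H₃ : Subgroup (GLm p m)}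

/-- **BLOCK COVER FORM in `GL_m(𝔽_p)`.**  If every `s ∈ SL₂(𝔽_p) ∖ 1` is `a b c` with
`a ⊕ 1 ∈ H₁`, `b ⊕ 1 ∈ H₂`, `c ⊕ 1 ∈ H₃` (`a, b, c ∈ GL₂(𝔽_p)`), then `(H₁, H₂, H₃)` carries no
level-one identity design. -/
theorem no_design_of_blockCover {t₀ : ZMod p} (ht₀ : ¬ IsSquare (t₀ ^ 2 - 4))
    (hcov : ∀ s : SL2 p, s ≠ 1 → ∃ a b c : GLm p 2, emb e a ∈ H₁ ∧ emb e b ∈ H₂ ∧ emb e c ∈ H₃ ∧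
      a * b * c = Matrix.SpecialLinearGroup.toGL s) :
    ¬ ∃ c : Mat p m → ℂ, (∀ M, 1 < M.rank → c M = 0) ∧
      (∑ M, c M * ZMod.stdAddChar (Matrix.trace (M * ((1 : GLm p m) : Mat p m)))) = 1 ∧
      ∀ a ∈ H₁, ∀ b ∈ H₂, ∀ g ∈ H₃, a * b * g ≠ 1 →
        (∑ M, c M * ZMod.stdAddChar (Matrix.trace (M * ((a * b * g : GLm p m) : Mat p m)))) = 0 :=
  fun hdes => no_design_of_cover (H₁ := H₁.comap (emb e)) (H₂ := H₂.comap (emb e))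
    (H₃ := H₃.comap (emb e)) ht₀
    (fun s hs => by
      obtain ⟨a, b, c, ha, hb, hc, h⟩ := hcov s hs
      exact ⟨a, Subgroup.mem_comap.mpr ha, b, Subgroup.mem_comap.mpr hb, c,
        Subgroup.mem_comap.mpr hc, h⟩)
    (design_comap e 1 hdes)

/-- **No member contains the block `SL₂(𝔽_p) ⊕ 1`** (`p` odd, any `m ≥ 2`, any two
coordinates): member `1`. -/
theorem no_design_mem₁_all (hp2 : p ≠ 2)
    (hSL : ∀ s : SL2 p, emb e (Matrix.SpecialLinearGroup.toGL s) ∈ H₁) :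
    ¬ ∃ c : Mat p m → ℂ, (∀ M, 1 < M.rank → c M = 0) ∧
      (∑ M, c M * ZMod.stdAddChar (Matrix.trace (M * ((1 : GLm p m) : Mat p m)))) = 1 ∧
      ∀ a ∈ H₁, ∀ b ∈ H₂, ∀ g ∈ H₃, a * b * g ≠ 1 →
        (∑ M, c M * ZMod.stdAddChar (Matrix.trace (M * ((a * b * g : GLm p m) : Mat p m)))) = 0 := by
  obtain ⟨t₀, ht₀⟩ := exists_elliptic hp2
  exact no_design_of_blockCover e ht₀ fun s _ =>
    ⟨_, 1, 1, hSL s, by rw [map_one]; exact H₂.one_mem, by rw [map_one]; exact H₃.one_mem,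
      by rw [mul_one, mul_one]⟩

/-- **No member contains the block `SL₂(𝔽_p) ⊕ 1`**: member `2`. -/
theorem no_design_mem₂_all (hp2 : p ≠ 2)
    (hSL : ∀ s : SL2 p, emb e (Matrix.SpecialLinearGroup.toGL s) ∈ H₂) :
    ¬ ∃ c : Mat p m → ℂ, (∀ M, 1 < M.rank → c M = 0) ∧
      (∑ M, c M * ZMod.stdAddChar (Matrix.trace (M * ((1 : GLm p m) : Mat p m)))) = 1 ∧
      ∀ a ∈ H₁, ∀ b ∈ H₂, ∀ g ∈ H₃, a * b * g ≠ 1 →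
        (∑ M, c M * ZMod.stdAddChar (Matrix.trace (M * ((a * b * g : GLm p m) : Mat p m)))) = 0 := by
  obtain ⟨t₀, ht₀⟩ := exists_elliptic hp2
  exact no_design_of_blockCover e ht₀ fun s _ =>
    ⟨1, _, 1, by rw [map_one]; exact H₁.one_mem, hSL s, by rw [map_one]; exact H₃.one_mem,
      by rw [one_mul, mul_one]⟩

/-- **No member contains the block `SL₂(𝔽_p) ⊕ 1`**: member `3`. -/
theorem no_design_mem₃_all (hp2 : p ≠ 2)
    (hSL : ∀ s : SL2 p, emb e (Matrix.SpecialLinearGroup.toGL s) ∈ H₃) :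
    ¬ ∃ c : Mat p m → ℂ, (∀ M, 1 < M.rank → c M = 0) ∧
      (∑ M, c M * ZMod.stdAddChar (Matrix.trace (M * ((1 : GLm p m) : Mat p m)))) = 1 ∧
      ∀ a ∈ H₁, ∀ b ∈ H₂, ∀ g ∈ H₃, a * b * g ≠ 1 →
        (∑ M, c M * ZMod.stdAddChar (Matrix.trace (M * ((a * b * g : GLm p m) : Mat p m)))) = 0 := by
  obtain ⟨t₀, ht₀⟩ := exists_elliptic hp2
  exact no_design_of_blockCover e ht₀ fun s _ =>
    ⟨1, 1, _, by rw [map_one]; exact H₁.one_mem, by rw [map_one]; exact H₂.one_mem, hSL s,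
      by rw [one_mul, one_mul]⟩

/-- **The TPP-compatible split `U⁻ ⊕ 1 ≤ H₁`, `N(T) ⊕ 1 ≤ H₂`, `U ⊕ 1 ≤ H₃` is impossible in
every `GL_m(𝔽_p)`** (`p` odd, any two coordinates). -/
theorem no_design_split_all (hp2 : p ≠ 2)
    (h₁ : ∀ x : ZMod p, emb e (Matrix.SpecialLinearGroup.toGL (lx x)) ∈ H₁)
    (h₂ : ∀ α : (ZMod p)ˣ, emb e (Matrix.SpecialLinearGroup.toGL (tdiag α)) ∈ H₂)
    (h₂' : ∀ α : (ZMod p)ˣ, emb e (Matrix.SpecialLinearGroup.toGL (tw α)) ∈ H₂)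
    (h₃ : ∀ y : ZMod p, emb e (Matrix.SpecialLinearGroup.toGL (ux y)) ∈ H₃) :
    ¬ ∃ c : Mat p m → ℂ, (∀ M, 1 < M.rank → c M = 0) ∧
      (∑ M, c M * ZMod.stdAddChar (Matrix.trace (M * ((1 : GLm p m) : Mat p m)))) = 1 ∧
      ∀ a ∈ H₁, ∀ b ∈ H₂, ∀ g ∈ H₃, a * b * g ≠ 1 →
        (∑ M, c M * ZMod.stdAddChar (Matrix.trace (M * ((a * b * g : GLm p m) : Mat p m)))) = 0 := by
  obtain ⟨t₀, ht₀⟩ := exists_elliptic hp2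
  refine no_design_of_blockCover e ht₀ fun s _ => ?_
  obtain ⟨x, y, α, h | h⟩ := cover_split s
  · exact ⟨_, _, _, h₁ x, h₂ α, h₃ y, by rw [h, map_mul, map_mul]⟩
  · exact ⟨1, _, _, by rw [map_one]; exact H₁.one_mem, h₂' α, h₃ y, by rw [h, map_mul, one_mul]⟩

end GLm

end CuspidalObstruction
end Summit.MatrixMultiplication.MatrixMultiplication.Theorems.SubgroupIdentityDesigns.Negative
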